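import Summits.Schanuel.Schanuel.Theorems.RootDecomp1KKummerClosure03

/-!
# RootDecomp1KKummerClosure («KUMMER CLOSURE», lens 6 gen 12/13 = 1K ROUND 9) — continuation (RootDecomp1KKummerClosure04): §K5 (second half) THE KUMMER ENGINE logCell_aeval_ne_zero (assembly of engine_lower / engine_upper; statement unchanged from gen 12) + algebraicIndependent_logCell

Part of the six-file split (400-line rule) of lens 6's node «KUMMER CLOSURE» = HOME/decomp-schanuel-lens-6/g13/addendum/KummerClosure.lean (v2, sha256 6dd432d1…, 1650 l;
= g12 v1 6d5e0790… with the engine re-cut into engine_lower / engine_upper at the census's request, every statement byte-identical; 1K ROUND 9 THEOREM ROUND on the critic's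
round-9 ACCEPTED-NEXT (i‴) «general Kummer closure with the UNIFORM degree bound»; `--supports stmt-Schanuel-33363`). Shared namespace
`Summit.Schanuel.Schanuel.Theorems.RootDecomp1KKummerClosure`; the node docstring is in part 01; K4's one-line copies of tree-private lemmas are private here.
Facts enter as hypotheses only (hNW : NesterenkoWaldschmidt1996_thm_1, hlm : Literature.Uncategorized.W78LogMeasure). Sorry-free; standard axioms. Nothing here proves Schanuel; rung 0.
-/

open Polynomial Complex IntermediateField
open Summit.Schanuel.Schanuel.Theorems.RootDecomp1KHyper
open Summit.Schanuel.Schanuel.Theorems.RootDecomp1KHyper.HyperCell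
open Summit.Schanuel.Schanuel.Theorems.RootDecomp1KRadical

noncomputable section

namespace Summit.Schanuel.Schanuel.Theorems.RootDecomp1KKummerClosure

/-- The Mahler measure of a non-zero integer polynomial (mapped to `ℂ`) is at least `1` (private copy of a tree-private wave lemma). -/
private theorem one_le_mahlerMeasure_map_of_ne_zero' {R : ℤ[X]} (hR : R ≠ 0) :
    1 ≤ (R.map (Int.castRingHom ℂ)).mahlerMeasure := by
  refine one_le_mahlerMeasure_of_one_le_norm_leadingCoeff ?_
  rw [Polynomial.leadingCoeff_map_of_injective (RingHom.injective_int _), eq_intCast,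
    Complex.norm_intCast]
  exact_mod_cast Int.one_le_abs (Polynomial.leadingCoeff_ne_zero.mpr hR)

open Literature.NumberTheory.Transcendental in
set_option maxHeartbeats 2000000 in
/-- **THE KUMMER ENGINE.**  `e^λ = α` algebraic, non-zero, NOT a root of unity, `λ` of finite
transcendence type, `ρ > 0` hyper-Liouville: `ρ, λ, e^{λρ}` satisfy no non-trivial integer polynomial
relation.  PROOF.  `P(ρ, λ, α^ρ) = 0`.  At a super-approximant `p/q` of `ρ` put `η = e^{λp/q}`:
`η^q = α^p`, so `η` is a root of the NORM POLYNOMIAL `E = Res_z(A(z), W^q − z^p) ∈ ℤ[W]`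
(`A` = the minimal integer polynomial of `α`; `deg E ≤ nq`, `M(E) ≤ 2^n M(A)^p`, §K3).  The eliminant
`S(Y) = Res_W(E(W), q^D P(p/q, Y, W)) ∈ ℤ[Y]` has `S(λ) = lc(E)^N ∏_{E(b)=0} q^D P(p/q, λ, b)`; the
factor at `b = η` is `≤ Q^D Kl |ρ − p/q| < e^{A₁Q²} e^{−Q^m}` (Lipschitz), the others `≤ Q^D B'`;
NO factor vanishes identically as a polynomial in `b` — by the UNIFORM KUMMER DEGREE BOUND (§K1–K2):
every root `b` of `E` is `z^{p/q}` for a conjugate `z` of `α`, so `[ℚ(b):ℚ] ≥ c(A) q > N ≥ deg_b`,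
while the one coefficient `G_{k₀} = q^D d(p/q) ≠ 0` (`q` beyond the denominators of the roots of `d`);
so `S ≠ 0` (`deg S ≤ nqK`, `log H(S) ≤ c_H Q²`), and the finite transcendence type of `λ` gives
`|S(λ)| ≥ e^{−A₃Q^{2k}}`, `k = τ + 3`, `m = 2k + 1` — contradiction for `Q ≥ A₁ + A₃ + 1`.
(gen 13: the two halves are `engine_lower` / `engine_upper`; statement unchanged.) -/
theorem logCell_aeval_ne_zero {lam α : ℂ} (hlam : cexp lam = α) (hft : FiniteTranscendenceType lam)
    (hαalg : IsAlgebraic ℚ α) (htor : ∀ n : ℕ, 0 < n → α ^ n ≠ 1)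
    {ρ : ℝ} (hρ : HyperLiouville ρ) (hρ0 : 0 < ρ) (P : MvPolynomial (Fin 3) ℤ) (hP : P ≠ 0) :
    MvPolynomial.aeval ![(ρ : ℂ), lam, cexp (lam * (ρ : ℂ))] P ≠ 0 := by
  classical
  intro hP0
  obtain ⟨c, τ, hc, hall⟩ := hft
  have hα0 : α ≠ 0 := by rw [← hlam]; exact Complex.exp_ne_zero _
  -- the irreducible integer polynomial `A` of `α`: degree `n`, Mahler measure `MA`, root bound `Zα`
  obtain ⟨A, hAirr, hAdeg, hAα⟩ := NesterenkoWaldschmidt1996.exists_irreducible_int_aeval_eq_zero hαalg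
  have hA0 : A ≠ 0 := hAirr.ne_zero
  obtain ⟨n, hndef⟩ : ∃ n : ℕ, n = A.natDegree := ⟨_, rfl⟩
  have hn1 : 1 ≤ n := by omega
  have hnr1 : (1 : ℝ) ≤ n := by exact_mod_cast hn1
  have hnr0 : (0 : ℝ) ≤ n := by linarith
  obtain ⟨MA, hMAdef⟩ : ∃ MA : ℝ, MA = (A.map (Int.castRingHom ℂ)).mahlerMeasure := ⟨_, rfl⟩
  have hMA1 : 1 ≤ MA := hMAdef ▸ one_le_mahlerMeasure_map_of_ne_zero' hA0
  obtain ⟨lMA, hlMA⟩ : ∃ lMA : ℝ, lMA = Real.log MA := ⟨_, rfl⟩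
  have hlMA0 : 0 ≤ lMA := hlMA ▸ Real.log_nonneg hMA1
  obtain ⟨Zα, hZα⟩ : ∃ Zα : ℝ,
      Zα = (((A.map (Int.castRingHom ℂ)).roots).map fun z => ‖z‖).sum + 1 := ⟨_, rfl⟩
  have hsum0 : 0 ≤ (((A.map (Int.castRingHom ℂ)).roots).map fun z => ‖z‖).sum :=
    Multiset.sum_nonneg fun x hx => by
      obtain ⟨y, _, rfl⟩ := Multiset.mem_map.mp hx; exact norm_nonneg y
  have hZroot : ∀ z ∈ (A.map (Int.castRingHom ℂ)).roots, ‖z‖ ≤ Zα := by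
    intro z hz
    rw [hZα]
    have h1 : ‖z‖ ≤ (((A.map (Int.castRingHom ℂ)).roots).map fun z => ‖z‖).sum :=
      Multiset.single_le_sum (fun x hx => by
        obtain ⟨y, _, rfl⟩ := Multiset.mem_map.mp hx; exact norm_nonneg y) _
        (Multiset.mem_map_of_mem _ hz)
    linarith
  have hZ1 : 1 ≤ Zα := by rw [hZα]; linarith
  have hZ0 : 0 ≤ Zα := by linarith
  -- the uniform Kummer degree constant `c₁ = c(A)`
  obtain ⟨c₁, hc₁, hdegb⟩ := kummer_degree_conj hAirr hAdeg hAα hα0 htor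
  -- exponents
  obtain ⟨k, hk⟩ : ∃ k : ℕ, k = τ + 3 := ⟨_, rfl⟩
  obtain ⟨m, hm⟩ : ∃ m : ℕ, m = 2 * k + 1 := ⟨_, rfl⟩
  have hm7 : 7 ≤ m := by omega
  have hτk : τ ≤ k := by omega
  have hk1 : 1 ≤ k := by omega
  -- data of `P`
  have hsupp : P.support.Nonempty :=
    Finset.nonempty_iff_ne_empty.mpr fun h => hP (MvPolynomial.support_eq_empty.mp h)
  obtain ⟨s₀, hs₀⟩ := hsupp
  obtain ⟨D, hDdef⟩ : ∃ D : ℕ, D = P.support.sup (fun s => s 0) := ⟨_, rfl⟩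
  obtain ⟨K, hKdef⟩ : ∃ K : ℕ, K = P.support.sup (fun s => s 1) := ⟨_, rfl⟩
  obtain ⟨N, hNdef⟩ : ∃ N : ℕ, N = P.support.sup (fun s => s 2) := ⟨_, rfl⟩
  have hD : ∀ s ∈ P.support, s 0 ≤ D := fun s hs =>
    hDdef ▸ Finset.le_sup (f := fun s : Fin 3 →₀ ℕ => s 0) hs
  have hK : ∀ s ∈ P.support, s 1 ≤ K := fun s hs =>
    hKdef ▸ Finset.le_sup (f := fun s : Fin 3 →₀ ℕ => s 1) hs
  have hN : ∀ s ∈ P.support, s 2 ≤ N := fun s hs =>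
    hNdef ▸ Finset.le_sup (f := fun s : Fin 3 →₀ ℕ => s 2) hs
  obtain ⟨Kl, δ₁, hKl0, hδ₁, hlip⟩ := exists_lipschitz_linF P lam lam ρ
  have hFρ : linF P lam lam ρ = 0 := by rw [linF_eq_aeval]; exact hP0
  -- constants (`a = |ρ| + 1`)
  obtain ⟨R₂, hR₂⟩ : ∃ R₂ : ℝ, R₂ = Real.exp (Zα * (|ρ| + 1)) := ⟨_, rfl⟩
  have hR₂0 : 0 ≤ R₂ := by rw [hR₂]; exact (Real.exp_pos _).le
  obtain ⟨B, hB⟩ : ∃ B : ℝ, B = ∑ s ∈ P.support,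
      ((|P.coeff s| : ℤ) : ℝ) * ((|ρ| + 1) ^ (s 0) * ‖lam‖ ^ (s 1) * R₂ ^ (s 2)) := ⟨_, rfl⟩
  obtain ⟨B', hB'⟩ : ∃ B' : ℝ, B' = max 1 B := ⟨_, rfl⟩
  have hB'1 : 1 ≤ B' := hB' ▸ le_max_left _ _
  have hBB' : B ≤ B' := hB' ▸ le_max_right _ _
  obtain ⟨AG, hAG⟩ : ∃ AG : ℝ,
      AG = ((K : ℝ) + 1) * (((N : ℝ) + 1) * ((cP P : ℝ) * (|ρ| + 2) ^ D)) := ⟨_, rfl⟩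
  have hcP1 : (1 : ℝ) ≤ cP P := by exact_mod_cast one_le_cP hs₀
  have hAG1 : 1 ≤ AG := by
    rw [hAG]
    have h3 : (1 : ℝ) ≤ (|ρ| + 2) ^ D := one_le_pow₀ (by linarith [abs_nonneg ρ])
    calc (1 : ℝ) = 1 * (1 * (1 * 1)) := by ring
      _ ≤ ((K : ℝ) + 1) * (((N : ℝ) + 1) * ((cP P : ℝ) * (|ρ| + 2) ^ D)) := by
          gcongr <;> linarith [Nat.cast_nonneg (α := ℝ) K, Nat.cast_nonneg (α := ℝ) N]
  have haρ : (0 : ℝ) ≤ |ρ| + 1 := by positivity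
  obtain ⟨cL, hcL⟩ : ∃ cL : ℝ, cL = (N : ℝ) * (n + lMA * (|ρ| + 1)) := ⟨_, rfl⟩
  obtain ⟨A₁, hA₁⟩ : ∃ A₁ : ℝ, A₁ = (2 * D + B' + Kl + 1) * (n : ℝ) ^ 2 + cL := ⟨_, rfl⟩
  obtain ⟨cN, hcN⟩ : ∃ cN : ℝ, cN = (n : ℝ) * K + 1 := ⟨_, rfl⟩
  obtain ⟨cT, hcT⟩ : ∃ cT : ℝ,
      cT = (n : ℝ) * K + n * AG + n * D + N * n + N * ((|ρ| + 1) * lMA) := ⟨_, rfl⟩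
  obtain ⟨cH, hcH⟩ : ∃ cH : ℝ, cH = 5 + cT := ⟨_, rfl⟩
  obtain ⟨A₃, hA₃⟩ : ∃ A₃ : ℝ, A₃ = c * (cH + cN) ^ k := ⟨_, rfl⟩
  have hA₁0 : 0 ≤ A₁ := by
    rw [hA₁, hcL]
    have : (0 : ℝ) ≤ 2 * D + B' + Kl + 1 := by positivity
    positivity
  have hA₃0 : 0 ≤ A₃ := by
    rw [hA₃, hcH, hcT, hcN]
    have h1 : (0 : ℝ) ≤ AG := by linarith
    positivity
  -- threshold and the super-approximant
  obtain ⟨q₀, hq₀def⟩ : ∃ q₀ : ℕ, q₀ = max (max (max 3 (denBound (torD P (s₀ 1) (s₀ 2))))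
      (max (⌈((N : ℝ) + 1) / c₁⌉₊ + 1) (⌈1 / δ₁⌉₊ + 1)))
      (max (⌈A₁ + A₃⌉₊ + 1) (⌈1 / ρ⌉₊ + 1)) := ⟨_, rfl⟩
  obtain ⟨r, hden, hρr, hη⟩ := hρ (max m q₀)
  have hq₀q : q₀ ≤ r.den := le_trans (le_max_right _ _) hden
  have hqm : m ≤ max m q₀ := le_max_left _ _
  have hqden : denBound (torD P (s₀ 1) (s₀ 2)) ≤ r.den := by rw [hq₀def] at hq₀q; omega
  have hqc₁ : ⌈((N : ℝ) + 1) / c₁⌉₊ + 1 ≤ r.den := by rw [hq₀def] at hq₀q; omega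
  have hqδ : ⌈1 / δ₁⌉₊ + 1 ≤ r.den := by rw [hq₀def] at hq₀q; omega
  have hqA : ⌈A₁ + A₃⌉₊ + 1 ≤ r.den := by rw [hq₀def] at hq₀q; omega
  have hqρ : ⌈1 / ρ⌉₊ + 1 ≤ r.den := by rw [hq₀def] at hq₀q; omega
  have hqpos : 0 < r.den := r.den_pos
  have hq0 : r.den ≠ 0 := r.den_nz
  obtain ⟨Q, hQ⟩ : ∃ Q : ℝ, Q = (r.den : ℝ) := ⟨_, rfl⟩
  have hQ1 : (1 : ℝ) ≤ Q := by rw [hQ]; exact_mod_cast hqpos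
  have hQ0 : (0 : ℝ) < Q := by linarith
  have hc₁q : (N : ℝ) < c₁ * r.den := by
    have h1 : (⌈((N : ℝ) + 1) / c₁⌉₊ : ℝ) + 1 ≤ r.den := by exact_mod_cast hqc₁
    have h2 : ((N : ℝ) + 1) / c₁ ≤ ⌈((N : ℝ) + 1) / c₁⌉₊ := Nat.le_ceil _
    have h3 : ((N : ℝ) + 1) / c₁ < r.den := by linarith
    rw [div_lt_iff₀ hc₁] at h3
    linarith
  -- the approximation `η = |ρ − r|`
  obtain ⟨η, hηdef⟩ : ∃ η : ℝ, η = |ρ - r| := ⟨_, rfl⟩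
  rw [← hηdef, ← hQ] at hη
  have hη0 : 0 < η := by rw [hηdef]; exact abs_pos.mpr (sub_ne_zero.mpr hρr)
  have hηm : η < Real.exp (-(Q ^ m)) := by
    refine hη.trans_le (Real.exp_le_exp.mpr ?_)
    rw [neg_le_neg_iff]
    exact pow_le_pow_right₀ hQ1 hqm
  have hη7 : η < Real.exp (-(Q ^ 7)) := eta_lt_exp_neg_pow_of_le hQ1 hm7 hηm
  have hη1 : η < 1 := by
    refine hη7.trans_le ?_
    rw [← Real.exp_zero]
    exact Real.exp_le_exp.mpr (by rw [neg_nonpos]; positivity)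
  have hηδ : η < δ₁ := eta_lt_delta hQ1 hδ₁ (by rw [hQ]; exact_mod_cast hqδ) hη7
  have hηρ : η < ρ := eta_lt_delta hQ1 hρ0 (by rw [hQ]; exact_mod_cast hqρ) hη7
  -- `r > 0`, numerator `pn > 0` coprime to `q`
  have hr0 : (0 : ℝ) < r := by
    have : ρ - r ≤ η := by rw [hηdef]; exact le_abs_self _
    linarith
  have hr0' : 0 < r := by exact_mod_cast hr0
  have hnum0 : 0 < r.num := Rat.num_pos.mpr hr0'
  obtain ⟨pn, hpn⟩ : ∃ pn : ℕ, pn = r.num.natAbs := ⟨_, rfl⟩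
  have hpnZ : (pn : ℤ) = r.num := by rw [hpn]; exact Int.natAbs_of_nonneg hnum0.le
  have hcop : Nat.Coprime pn r.den := by rw [hpn]; exact r.reduced
  have hrabs : |(r : ℝ)| ≤ |ρ| + 1 := by
    have h1 : |(r : ℝ)| ≤ |ρ| + |ρ - r| := by
      have := abs_sub_abs_le_abs_sub (r : ℝ) ρ
      rw [abs_sub_comm] at this
      linarith
    rw [← hηdef] at h1
    linarith
  have hpabs : |(r.num : ℝ)| ≤ (|ρ| + 1) * Q := by
    have e : (r : ℝ) = (r.num : ℝ) / (r.den : ℝ) := by exact_mod_cast (Rat.num_div_den r).symm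
    have h := hrabs
    rw [e, abs_div, Nat.abs_cast, div_le_iff₀ (by exact_mod_cast hqpos : (0 : ℝ) < r.den), ← hQ] at h
    exact h
  have hpnQ : (pn : ℝ) ≤ (|ρ| + 1) * Q := by
    have : (pn : ℝ) = |(r.num : ℝ)| := by
      rw [hpn, Nat.cast_natAbs, Int.cast_abs]
    rw [this]; exact hpabs
  -- the norm polynomial `E = E_{pn,q}` of the radicals and its complex roots
  obtain ⟨E, hEdef⟩ : ∃ E : ℤ[X], E = normPoly A pn r.den := ⟨_, rfl⟩
  have hE0 : E ≠ 0 := hEdef ▸ normPoly_ne_zero hA0 pn r.den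
  have hmem_roots : ∀ b : ℂ, b ∈ (E.map (Int.castRingHom ℂ)).roots ↔
      ∃ z ∈ (A.map (Int.castRingHom ℂ)).roots, b ^ r.den = z ^ pn := by
    intro b; rw [hEdef]; exact mem_roots_normPoly hA0 hqpos
  have hdegE : E.natDegree ≤ n * r.den := by
    rw [hEdef, hndef]; exact natDegree_normPoly_le A pn r.den
  have hME : (E.map (Int.castRingHom ℂ)).mahlerMeasure ≤ 2 ^ n * MA ^ pn := by
    rw [hEdef, hndef, hMAdef]; exact mahlerMeasure_normPoly_le hA0 hqpos
  have hroot_norm : ∀ b ∈ (E.map (Int.castRingHom ℂ)).roots, ‖b‖ ≤ R₂ := by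
    intro b hb
    obtain ⟨z, hz, hbz⟩ := (hmem_roots b).mp hb
    rw [hR₂]
    exact norm_le_exp_of_pow_eq_pow hq0 hbz hZ0 (hZroot z hz) hQ hpnQ
  -- the family `G`, and NON-VANISHING of every conjugate factor (uniform Kummer degree bound)
  obtain ⟨G, hGdef⟩ : ∃ G : Fin (K + 1) → ℤ[X], G = torG P D r.num r.den K := ⟨_, rfl⟩
  have hGN : ∀ i, (G i).natDegree ≤ N := fun i =>
    hGdef ▸ natDegree_torG_le P D r.num r.den K hN i
  have hs₀K : s₀ 1 ≤ K := hK s₀ hs₀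
  have hfacne : ∀ b ∈ (E.map (Int.castRingHom ℂ)).roots, conjFactor G b ≠ 0 := by
    intro b hb
    obtain ⟨z, hz, hbz⟩ := (hmem_roots b).mp hb
    rw [hGdef]
    exact conjFactor_torG_ne_zero_of_degree P D hD hN hs₀ hs₀K r hqden hc₁q
      (fun g hg hgb => hdegb z hz pn r.den b hqpos hcop hbz g hg hgb)
  have hrelLen : relLen G ≤ AG * Q ^ D := by
    rw [hGdef]
    refine (relLen_torG_le P D r.num r.den hD hN).trans ?_
    rw [hAG, ← hQ]
    have h1 : (|(r.num : ℝ)| + Q) ^ D ≤ ((|ρ| + 2) * Q) ^ D := by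
      apply pow_le_pow_left₀ (by positivity)
      linarith [hpabs]
    rw [mul_pow] at h1
    have hc0 : (0 : ℝ) ≤ (cP P : ℝ) := by linarith
    calc ((K : ℝ) + 1) * (((N : ℝ) + 1) * ((cP P : ℝ) * (|(r.num : ℝ)| + Q) ^ D))
        ≤ ((K : ℝ) + 1) * (((N : ℝ) + 1) * ((cP P : ℝ) * ((|ρ| + 2) ^ D * Q ^ D))) := by
          gcongr
      _ = ((K : ℝ) + 1) * (((N : ℝ) + 1) * ((cP P : ℝ) * (|ρ| + 2) ^ D)) * Q ^ D := by
          ring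
  -- (L) the lower bound from the finite-type measure of `λ`
  have hlow : Real.exp (-(A₃ * Q ^ (2 * k))) ≤ ‖aeval lam (resPoly E G N)‖ :=
    engine_lower hc hτk hall hE0 hqpos hdegE hMA1 hlMA hME hGN hfacne hQ hAG1 haρ hpnQ hrelLen
      hcN hcT hcH hA₃
  -- (U) the special root `w = e^{λ r}` of `E` and the factor bounds
  obtain ⟨w, hw⟩ : ∃ w : ℂ, w = cexp (lam * ((r : ℝ) : ℂ)) := ⟨_, rfl⟩
  have hwq : w ^ r.den = α ^ pn := by rw [hw, ← hlam]; exact cexp_mul_ratCast_pow lam hpnZ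
  have hwmem : w ∈ (E.map (Int.castRingHom ℂ)).roots :=
    (hmem_roots w).mpr ⟨α, mem_roots_map_of_aeval hA0 hAα, hwq⟩
  have hfac : ∀ b : ℂ, (conjFactor G b).eval lam =
      (r.den : ℂ) ^ D * MvPolynomial.aeval ![((r.num : ℂ) / r.den), lam, b] P := by
    intro b; rw [hGdef]; exact eval_conjFactor_torG P D r.num r.den hD hK hq0 b _
  have hrC : ((r : ℝ) : ℂ) = (r.num : ℂ) / r.den := by
    rw [Complex.ofReal_ratCast, Rat.cast_def]
  have hnormq : ‖((r.den : ℂ)) ^ D‖ = Q ^ D := by rw [norm_pow, Complex.norm_natCast, hQ]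
  have hwfac : ‖(conjFactor G w).eval lam‖ ≤ Q ^ D * (Kl * η) := by
    rw [hfac w, norm_mul, hnormq]
    refine mul_le_mul_of_nonneg_left ?_ (by positivity)
    have e1 : MvPolynomial.aeval ![((r.num : ℂ) / r.den), lam, w] P = linF P lam lam r := by
      rw [linF_eq_aeval, hw, ← hrC]
    rw [e1, ← sub_zero (linF P lam lam r), ← hFρ]
    have h1 : |(r : ℝ) - ρ| < δ₁ := by rw [abs_sub_comm, ← hηdef]; exact hηδ
    have h2 := hlip r h1
    rw [abs_sub_comm, ← hηdef] at h2
    exact h2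
  have hofac : ∀ b ∈ (E.map (Int.castRingHom ℂ)).roots,
      ‖(conjFactor G b).eval lam‖ ≤ Q ^ D * B' := by
    intro b hb
    rw [hfac b, norm_mul, hnormq]
    refine mul_le_mul_of_nonneg_left (le_trans ?_ hBB') (by positivity)
    rw [hB]
    refine norm_mvaeval_le P _ ?_ ?_ ?_
    · show ‖((r.num : ℂ) / r.den)‖ ≤ |ρ| + 1
      rw [← hrC, Complex.norm_real, Real.norm_eq_abs]; exact hrabs
    · show ‖lam‖ ≤ ‖lam‖
      exact le_rfl
    · show ‖b‖ ≤ R₂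
      exact hroot_norm b hb
  have hup : ‖aeval lam (resPoly E G N)‖ ≤ Real.exp (A₁ * Q ^ 2) * η :=
    engine_upper hn1 hqpos hdegE hMA1 hlMA hME hGN hQ haρ hpnQ hB'1 hKl0 hη0.le hwmem hwfac hofac
      hcL hA₁
  -- (E) endgame
  have hchain : Real.exp (-(A₃ * Q ^ (2 * k))) < Real.exp (A₁ * Q ^ 2) * Real.exp (-(Q ^ m)) :=
    calc Real.exp (-(A₃ * Q ^ (2 * k))) ≤ ‖aeval lam (resPoly E G N)‖ := hlow
      _ ≤ Real.exp (A₁ * Q ^ 2) * η := hup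
      _ < Real.exp (A₁ * Q ^ 2) * Real.exp (-(Q ^ m)) :=
          mul_lt_mul_of_pos_left hηm (Real.exp_pos _)
  rw [← Real.exp_add, Real.exp_lt_exp] at hchain
  have hQA : A₁ + A₃ + 1 ≤ Q := by
    have hc' : (⌈A₁ + A₃⌉₊ : ℝ) + 1 ≤ Q := by rw [hQ]; exact_mod_cast hqA
    linarith [Nat.le_ceil (A₁ + A₃)]
  exact endgame_type hQ1 hA₁0 hA₃0 hQA hk1 hm hchain

/-- **The engine, algebraic form**: `ρ, λ, e^{λρ}` are algebraically independent over `ℚ`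
(`e^λ = α ∈ ℚ̄`, not a root of unity, `λ` of finite transcendence type, `ρ > 0` hyper-Liouville). -/
theorem algebraicIndependent_logCell {lam α : ℂ} (hlam : cexp lam = α)
    (hft : FiniteTranscendenceType lam) (hαalg : IsAlgebraic ℚ α)
    (htor : ∀ n : ℕ, 0 < n → α ^ n ≠ 1) {ρ : ℝ} (hρ : HyperLiouville ρ) (hρ0 : 0 < ρ) :
    AlgebraicIndependent ℚ ![(ρ : ℂ), lam, cexp (lam * (ρ : ℂ))] :=
  algebraicIndependent_of_forall_int fun G hG => logCell_aeval_ne_zero hlam hft hαalg htor hρ hρ0 G hG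

end Summit.Schanuel.Schanuel.Theorems.RootDecomp1KKummerClosure
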